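import Summits.AnomalousDissipation.AnomalousDissipation.Theorems.SolenoidalFractalHomogenisationLagrangianStepZ7GlueEulerXOfVRH0FS
import Summits.AnomalousDissipation.AnomalousDissipation.Theorems.SolenoidalFractalHomogenisationLagrangianStepZ7GlueEulerDefsK
import Summits.AnomalousDissipation.AnomalousDissipation.Theorems.SolenoidalFractalHomogenisationLagrangianStepFrameConjugacyJA
import Summits.AnomalousDissipation.AnomalousDissipation.Theorems.SolenoidalFractalHomogenisationLagrangianStepFrameInstanceRegularity
import HarnessLib

/-!
# K1L_D (stmt-AnomalousDissipation-27980), (ℓ3-A) road A: THE FINAL HEAD OF RECORD over the v3A texts (RULING D28-23) —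
# `Z7Glue.vmod_EXK_of_VRH0FJA X e he : ⟨∀ design data: (V) → X → W7 → ∃ θ₁ ϱ₁ Cm, C ≤ Cm ∧ VmodDist.SlowVectorClauseModECW0FJA … (e σ) Cm ν₀ K θ₁ ϱ₁⟩ → Z7Glue.Vmod_E_textHTXK X e`
(helper, `--supports 27980 --as helper`; prover lead-k1l-onelevel-p1 g8; tenure RULINGS D28-22 (1) (`PieceTK`), D28-22′ (F6), D28-23, D28-25 (2b); FINDING F-lead-g8-1.)

PORT of `…Z7GlueEulerXOfVRH0FS` (p725294) to the v3A internal text `VmodDist.SlowVectorClauseModECW0FJA` (`…VmodFrameDefsJA`, p728259): the bracket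
now also binds a pointwise inverse frame `J` with `IsFrameRegular θ Tw nC G J`, the (F6) token `IsFrameRegular6 θ Tw nC G J`, and the cascade token
`nC ≤ ϱ₁·(ν/K)^{4/3}·n`; the conclusion is the K-text `Vmod_E_textHTXK` (= `Vmod_E_textHTX` over `SlowVectorClauseEulerPieceTK`, whose extra binder
`hKr : K·(N(m+1)/N m)^{1/4} ≤ (N(m+1)/N m)·cellVisc (m+1)` IS the ν-token: `N m ≤ (cellVisc/K)^{4/3}·N(m+1)`, lemma `N_le_rpow_mul_N_of_hKr`).
Discharges at the head: the frame `Gclamp` and its Jacobian `Jclamp` (`FrameForm.isFrameModulation_frameG_closed_pos`,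
`FrameInst.isFrameRegular_frameG_closed_pos`), RESCALED (F-lead-g8-1, `…FrameConjugacyJA` §1) to `θ' = (max Cα Cr)/λ⁶ · strain m`,
`nC' = λ·max(ϱ,ϱr)·N m ≤ ϱ₁·N m` with `λ = min 1 (ϱ₁ / max ϱ ϱr)` so that BOTH `nC' ≤ ϱ₁ n` and `nC' ≤ ϱ₁ (ν/K)^{4/3} n` follow from `N m ≤ N(m+1)` and
`hKr` alone (ϱ₁ is the provider's constant); the two distorted members and the readings from `FrameInst.frameConjugacy_unpacked_of_modulation`; step
(b)+(c) by `FrameInst.lossBound_of_frameKey`; constants `θ₁' = min (frame ceilings) (θ₁ λ⁶ / max Cα Cr)`, `ϱ₁' = 1` (the binder `N m ≤ ϱ₁' N(m+1)` is idle),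
`Cm' = Cm·Lσ`, `Lσ = (max 1 (max Cθ ϱ'))^{e σ}` — the absorption algebra of the FS head verbatim.  With this file the v29 registered stub
`stub_Vmod_EHTthgw : Vmod_E_textHTXK Xθgw (fun σ => min (σ/2) (1/2))` is BY NAME `vmod_EXK_of_VRH0FJA Z7Glue.Xθgw _ _ ⟨(V)+(Xθgw)+W7 ⇒ ∃ θ₁ ϱ₁ Cm, ModECW0FJA⟩`
— the bracket is what the v3A assembly `VmodDist.modECW0FJA_of_blockBoundsGJA_at` (p3) delivers from the four J-cut blocks and (M_θ).
No sorry, no definition, no named fact.  NOT a proof of `stub_Vmod_EHTthgw`, of K1L_D or of AD; rung F-D1.A0.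
-/

set_option linter.dupNamespace false

noncomputable section

namespace Summit.AnomalousDissipation.AnomalousDissipation.Theorems.SolenoidalFractalHomogenisation.LagrangianStep.Z7Glue

open Literature.Analysis Literature.Analysis.FluidPDE Literature.Analysis.FunctionSpaces
open MeasureTheory Set
open scoped InnerProductSpace
open Literature.Analysis.FluidPDE.LatticeShear (LagrangianLatticeCarrier LatticeWord)
open Summit.AnomalousDissipation.AnomalousDissipation.Theorems.SolenoidalFractalHomogenisation.LagrangianStep.CellClauseMod
open Summit.AnomalousDissipation.AnomalousDissipation.Theorems.SolenoidalFractalHomogenisation.LagrangianStep.VmodDist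
open Summit.AnomalousDissipation.AnomalousDissipation.Theorems.SolenoidalFractalHomogenisation.LagrangianStep.FrameConj
open Summit.AnomalousDissipation.AnomalousDissipation.Theorems.SolenoidalFractalHomogenisation.LagrangianStep.FrameForm
open Summit.AnomalousDissipation.AnomalousDissipation.Theorems.SolenoidalFractalHomogenisation.LagrangianStep.FrameInst

/-! ## §1 The ν-token from the `PieceTK` binder -/

/-- **The cascade token from `hKr`**: for positive `K, ν, N₀, N₁`, `K·(N₁/N₀)^{1/4} ≤ (N₁/N₀)·ν` gives `N₀ ≤ (ν/K)^{4/3}·N₁`. -/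
theorem N_le_rpow_mul_N_of_hKr {K ν N₀ N₁ : ℝ} (hK : 0 < K) (hν : 0 < ν) (hN₀ : 0 < N₀) (hN₁ : 0 < N₁)
    (hKr : K * (N₁ / N₀) ^ (1 / 4 : ℝ) ≤ (N₁ / N₀) * ν) : N₀ ≤ (ν / K) ^ (4 / 3 : ℝ) * N₁ := by
  set r : ℝ := N₁ / N₀ with hr
  have hr0 : 0 < r := div_pos hN₁ hN₀
  -- `K/ν ≤ r^{3/4}`
  have h1 : K / ν ≤ r ^ (3 / 4 : ℝ) := by
    have e : r = r ^ (1 / 4 : ℝ) * r ^ (3 / 4 : ℝ) := by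
      rw [← Real.rpow_add hr0]; norm_num
    have h2 : K * r ^ (1 / 4 : ℝ) ≤ (r ^ (3 / 4 : ℝ) * ν) * r ^ (1 / 4 : ℝ) := by
      calc K * r ^ (1 / 4 : ℝ) ≤ r * ν := hKr
        _ = (r ^ (1 / 4 : ℝ) * r ^ (3 / 4 : ℝ)) * ν := by rw [← e]
        _ = (r ^ (3 / 4 : ℝ) * ν) * r ^ (1 / 4 : ℝ) := by ring
    have h3 : K ≤ r ^ (3 / 4 : ℝ) * ν := le_of_mul_le_mul_right h2 (Real.rpow_pos_of_pos hr0 _)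
    rw [div_le_iff₀ hν]; exact h3
  -- `(K/ν)^{4/3} ≤ r`
  have h2 : (K / ν) ^ (4 / 3 : ℝ) ≤ r := by
    have h := Real.rpow_le_rpow (div_pos hK hν).le h1 (by norm_num : (0:ℝ) ≤ 4 / 3)
    rwa [← Real.rpow_mul hr0.le, show (3 / 4 : ℝ) * (4 / 3) = 1 by norm_num, Real.rpow_one] at h
  -- invert
  have h3 : 1 / r ≤ (ν / K) ^ (4 / 3 : ℝ) := by
    have hKν : 0 < (K / ν) ^ (4 / 3 : ℝ) := Real.rpow_pos_of_pos (div_pos hK hν) _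
    have e : (ν / K) ^ (4 / 3 : ℝ) = 1 / (K / ν) ^ (4 / 3 : ℝ) := by
      rw [Real.div_rpow hν.le hK.le, Real.div_rpow hK.le hν.le, one_div_div]
    rw [e]
    exact one_div_le_one_div_of_le hKν h2
  calc N₀ = (1 / r) * N₁ := by rw [hr]; field_simp
    _ ≤ (ν / K) ^ (4 / 3 : ℝ) * N₁ := mul_le_mul_of_nonneg_right h3 hN₁.le

/-! ## §2 The head -/

set_option maxHeartbeats 800000 in
/-- **The (ℓ3-A) FINAL HEAD over the v3A texts (D28-23).**  If for every design datum (V), `X` and the W7 family give constants `θ₁ ϱ₁ Cm` with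
`VmodDist.SlowVectorClauseModECW0FJA … (e σ) Cm ν₀ K θ₁ ϱ₁`, then `Vmod_E_textHTXK X e`.  Proof = `vmod_EX_of_VRH0FS` with: intro of `hKr`; the
frame `Gclamp` (modulation datum) AND its Jacobian `Jclamp` (`IsFrameRegular`, `IsFrameRegular6`) rescaled to `(θ', nC') = ((max Cα Cr)/λ⁶·strain, λ·max(ϱ,ϱr)·N m)`,
`λ = min 1 (ϱ₁/max ϱ ϱr)`; the ν-token from `hKr`; unpacked conjugacy; step (b)+(c) generic; constants `θ₁' = min (…) (θ₁λ⁶/max Cα Cr)`, `ϱ₁' = 1`, `Cm' = Cm·Lσ`.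
(R-λ, RULING D28-27: `λ` — hence `Cθ = max Cα Cr/λ⁶`, `ϱ' = λ·max ϱ ϱr`, `θ₁'`, `Cm'` — is a FIXED constant of the design's frame ceilings and of the provider's
`ϱ₁`; it does not depend on the level `m`, on `ν = cellVisc (m+1)`, or on `K`.) -/
theorem vmod_EXK_of_VRH0FJA
    (X : ∀ {k : ℕ}, LatticeWord k → (M : ℝ) → 0 < M → ℝ → (ℝ → Torus.Visc4 (Fin 3) → Torus.Visc4 (Fin 3)) → ℝ → ℝ → ℝ → ℝ → ℝ → ℝ → ℝ → ℝ → Prop)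
    (e : ℝ → ℝ) (he : ∀ σ : ℝ, 0 < σ → 0 < e σ)
    (H : ∀ k (W : LatticeWord k) (M : ℝ) (hM : 0 < M) (c : ℝ), 0 < c →
      ∀ (Φ : ℝ → Torus.Visc4 (Fin 3) → Torus.Visc4 (Fin 3)) (lo hi Λ β σ C ν₀ K : ℝ),
        0 < lo → lo ≤ 1 → 1 ≤ hi → 1 < Λ → 0 ≤ β → 0 < σ → 0 ≤ C → 0 < ν₀ → ν₀ ≤ 1 → 0 < K →
        SlowVectorClauseF W M hM c Φ lo hi Λ β σ C ν₀ K →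
        X W M hM c Φ lo hi Λ β σ C ν₀ K →
        (∀ Kb : ℝ, 1 ≤ Kb → ∃ CK : ℝ, 1 ≤ CK ∧ ∃ cK > (0:ℝ), ∃ νh > (0:ℝ), HighLabelDecayW W M hM lo hi Λ β νh Kb CK cK) →
        ∃ θ₁ > (0:ℝ), ∃ ϱ₁ > (0:ℝ), ∃ Cm : ℝ, C ≤ Cm ∧
          VmodDist.SlowVectorClauseModECW0FJA W M hM c Φ lo hi Λ β (e σ) Cm ν₀ K θ₁ ϱ₁) :
    Vmod_E_textHTXK X e := by
  intro k W M hM c hc Φ lo hi Λ β σ C ν₀ K hlo hlo1 hhi hΛ hβ hσ hC hν₀ hν₀1 hK hV hXv hH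
  obtain ⟨θ₁, hθ₁, ϱ₁, hϱ₁, Cm, hCCm, hMod⟩ := H k W M hM c hc Φ lo hi Λ β σ C ν₀ K hlo hlo1 hhi hΛ hβ hσ hC hν₀ hν₀1 hK hV hXv hH
  set σ' : ℝ := e σ with hσ'
  have hσ'0 : 0 < σ' := he σ hσ
  have hCm : 0 ≤ Cm := hC.trans hCCm
  -- the frame ceilings of the design
  obtain ⟨θs₁, hθs₁, Cα, hCα, Hmod⟩ := isFrameModulation_frameG_closed_pos k (W.stretch M hM)
  obtain ⟨θs₂, hθs₂, Cs, hCs, Hcurv⟩ := abs_partialDeriv_frameG_le k (W.stretch M hM)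
  obtain ⟨θs₃, hθs₃, Cr, hCr, ϱr, hϱr, Hreg⟩ := isFrameRegular_frameG_closed_pos k W M hM
  set ϱ : ℝ := (Cs + 1) / Cα with hϱdef
  have hϱ : 0 < ϱ := by rw [hϱdef]; positivity
  -- the rescaling (F-lead-g8-1)
  set ϱs : ℝ := max ϱ ϱr with hϱs
  have hϱs0 : 0 < ϱs := lt_max_of_lt_left hϱ
  set lam : ℝ := min 1 (ϱ₁ / ϱs) with hlam
  have hlam0 : 0 < lam := lt_min one_pos (div_pos hϱ₁ hϱs0)
  have hlam1 : lam ≤ 1 := min_le_left _ _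
  have hlamϱ : lam * ϱs ≤ ϱ₁ := by
    calc lam * ϱs ≤ (ϱ₁ / ϱs) * ϱs := mul_le_mul_of_nonneg_right (min_le_right _ _) hϱs0.le
      _ = ϱ₁ := by field_simp
  set CM : ℝ := max Cα Cr with hCM
  have hCM0 : 0 < CM := lt_max_of_lt_left hCα
  set Cθ : ℝ := CM / lam ^ 6 with hCθ
  have hCθ0 : 0 < Cθ := by positivity
  set ϱ' : ℝ := lam * ϱs with hϱ'
  have hϱ'0 : 0 < ϱ' := mul_pos hlam0 hϱs0
  -- the clause's constants
  set L : ℝ := max 1 (max Cθ ϱ') with hLdef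
  have hL1 : 1 ≤ L := le_max_left _ _
  have hCθL : Cθ ≤ L := (le_max_left _ _).trans (le_max_right _ _)
  have hϱL : ϱ' ≤ L := (le_max_right _ _).trans (le_max_right _ _)
  set Lσ : ℝ := L ^ σ' with hLσ
  have hLσ1 : 1 ≤ Lσ := by rw [hLσ]; exact Real.one_le_rpow hL1 hσ'0.le
  refine ⟨min (min θs₁ (min θs₂ θs₃)) (θ₁ * lam ^ 6 / CM),
    lt_min (lt_min hθs₁ (lt_min hθs₂ hθs₃)) (by positivity), 1, one_pos, Cm * Lσ,
    hCCm.trans (le_mul_of_one_le_right hCm hLσ1), ?_⟩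
  intro E hdes hgain hLP hReg hN2 hT4 m hνν₀ hKn hKr _hNle S hSo hSw hΦSo hΦSw Um Um1 hUm hUm1 j s t hs hst htR ht1 x y
  -- level data
  have hLR := hReg.levelRegular
  set R : ℝ := E.refresh (m + 1) with hRdef
  have hR : 0 < R := E.refresh_pos (m + 1)
  set ν : ℝ := E.cellVisc (m + 1) with hνdef
  have hν : 0 < ν := LagrangianRenormalisationStep.cellVisc_pos' E.toFractalCarrierData (m + 1)
  have hνI : ν ∈ Set.Ioo 0 ν₀ := ⟨hν, hνν₀⟩
  have hj0 : 0 ≤ (j : ℝ) * R := mul_nonneg (Nat.cast_nonneg j) hR.le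
  have hκ0 : 0 < E.kbar m := E.kbar_pos m
  have hκ1 : 0 < E.kbar (m + 1) := E.kbar_pos (m + 1)
  have hg : 0 ≤ E.gain / ν ^ 2 := div_nonneg (by rw [hgain]; exact hc.le) (sq_nonneg _)
  have hT4₁ : ∀ m, E.θ (m + 1) * ((E.N (m + 1) : ℝ) / E.N m) ^ (1 / 16 : ℝ) ≤ θs₁ := fun m =>
    (hT4 m).trans ((min_le_left _ _).trans (min_le_left _ _))
  have hT4₂ : ∀ m, E.θ (m + 1) * ((E.N (m + 1) : ℝ) / E.N m) ^ (1 / 16 : ℝ) ≤ θs₂ := fun m =>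
    (hT4 m).trans ((min_le_left _ _).trans ((min_le_right _ _).trans (min_le_left _ _)))
  have hT4₃ : ∀ m, E.θ (m + 1) * ((E.N (m + 1) : ℝ) / E.N m) ^ (1 / 16 : ℝ) ≤ θs₃ := fun m =>
    (hT4 m).trans ((min_le_left _ _).trans ((min_le_right _ _).trans (min_le_right _ _)))
  have hθm : E.θ (m + 1) ≤ θ₁ * lam ^ 6 / CM := (theta_le_of_template E hLP hT4 m).trans (min_le_right _ _)
  have hNm : (0 : ℝ) < E.N m := by exact_mod_cast E.N_pos m
  have hN : (0 : ℝ) < E.N (m + 1) := by exact_mod_cast E.N_pos (m + 1)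
  have hNmono : (E.N m : ℝ) ≤ E.N (m + 1) := by
    have h : (2 : ℝ) * E.N m ≤ E.N (m + 1) := by exact_mod_cast hLP.permissible.2.2.1 m
    linarith
  -- the two Eulerian tensors are elliptic (common window `lo/Λ, hi·Λ`)
  have hΛ0 : 0 < Λ := by linarith
  obtain ⟨lam₁, hlam₁, hSn⟩ := hSw
  obtain ⟨lam', hlam', hΦSn⟩ := hΦSw
  have hlam₁0 : 0 < lam₁ := by linarith [hlam₁.1]
  have hlam'0 : 0 < lam' := by linarith [hlam'.1]
  have hhi0 : 0 ≤ hi := by linarith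
  have hSn' : Torus.NearIso S (lo / Λ) (hi * Λ) :=
    hSn.mono (div_le_div_of_nonneg_left hlo.le hlam₁0 hlam₁.2) (mul_le_mul_of_nonneg_left hlam₁.2 hhi0)
  have hΦSn' : Torus.NearIso (Φ ν S) (lo / Λ) (hi * Λ) :=
    hΦSn.mono (div_le_div_of_nonneg_left hlo.le hlam'0 hlam'.2) (mul_le_mul_of_nonneg_left hlam'.2 hhi0)
  have hloΛ : 0 < lo / Λ := div_pos hlo hΛ0
  have h𝔸1 : Torus.NearIso (E.kbar (m + 1) • S) (E.kbar (m + 1) * (lo / Λ)) (E.kbar (m + 1) * (hi * Λ)) := hSn'.smul hκ1.le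
  have hlo₁ : 0 < E.kbar (m + 1) * (lo / Λ) := mul_pos hκ1 hloΛ
  have h𝔸0 : Torus.NearIso (E.kbar m • renormStep (Φ ν) (E.gain / ν ^ 2) S) (E.kbar m * (lo / Λ)) (E.kbar m * (hi * Λ)) :=
    (nearIso_renormStep hg hSn' hΦSn').smul hκ0.le
  have hlo₀ : 0 < E.kbar m * (lo / Λ) := mul_pos hκ0 hloΛ
  -- the frame on the closed piece `[jR, t]`
  have hstrain0 : 0 ≤ E.strain m := by
    unfold LagrangianLatticeCarrier.strain
    exact mul_nonneg (Finset.sum_nonneg fun i _ => (E.toFractalCarrierData.a_pos (i + 1)).le) (E.refresh_pos (m + 1)).le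
  have hjt : (j : ℝ) * R < t := by rw [← hs]; exact hst
  have htR' : t ≤ (j : ℝ) * R + R := by rw [← hs]; exact htR
  have htR'' : t ≤ ((j : ℝ) + 1) * R := by rw [add_one_mul]; exact htR'
  set Tw : ℝ := E.a (m + 1) * (t - (j : ℝ) * R) with hTwdef
  have hTw : 0 < Tw := mul_pos (E.a_pos (m + 1)) (by linarith)
  have hmod : IsFrameModulation (Cα * E.strain m) Tw (ϱ * E.N m)
      (fun τ y => frameG E m ((j : ℝ) * R + max 0 (min τ (E.a (m + 1) * (t - (j : ℝ) * R))) / E.a (m + 1)) ((j : ℝ) * R) y) := by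
    have hc' : ∀ u ∈ Icc 0 (t - ((j : ℤ) : ℝ) * E.refresh (m + 1)), ∀ (y : UnitAddTorus (Fin 3)) (i l c : Fin 3),
        |Torus.partialDeriv c (fun y => frameG E m (((j : ℤ) : ℝ) * E.refresh (m + 1) + u) (((j : ℤ) : ℝ) * E.refresh (m + 1)) y i l) y|
          ≤ (Cα * E.strain m) * (ϱ * E.N m) := by
      intro u hu y i l c'
      have h := Hcurv E _ hdes (le_refl θs₂) hLP hReg hN2 hT4₂ m (j : ℤ) t (by push_cast; exact hjt) (by push_cast; exact htR'') u hu y i l c'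
      refine h.trans ?_
      have e1 : Cα * E.strain m * (ϱ * E.N m) = (Cs + 1) * E.N m * E.strain m := by
        rw [hϱdef]; field_simp
      rw [e1]
      exact mul_le_mul_of_nonneg_right (mul_le_mul_of_nonneg_right (by linarith) hNm.le) hstrain0
    have h := Hmod E _ hdes (le_refl θs₁) hLP hReg hN2 hT4₁ m (j : ℤ) t (by push_cast; exact hjt) (by push_cast; exact htR'') (ϱ * E.N m) hc'
    push_cast at h
    exact h
  have hreg := Hreg E _ hdes (le_refl θs₃) hLP hReg hN2 hT4₃ m (j : ℤ) t (by push_cast; exact hjt) (by push_cast; exact htR'')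
  push_cast at hreg
  -- the rescaled data `(θ', nC')`
  set θ' : ℝ := Cθ * E.strain m with hθ'def
  set nC' : ℝ := ϱ' * E.N m with hnC'def
  have hθ'0 : 0 ≤ θ' := mul_nonneg hCθ0.le hstrain0
  have hnC'0 : 0 ≤ nC' := mul_nonneg hϱ'0.le hNm.le
  have hθ'le : θ' ≤ Cθ * E.θ (m + 1) := mul_le_mul_of_nonneg_left (hLP.strain_le m) hCθ0.le
  have hθ'1 : θ' ≤ θ₁ := by
    calc θ' ≤ Cθ * E.θ (m + 1) := hθ'le
      _ ≤ Cθ * (θ₁ * lam ^ 6 / CM) := mul_le_mul_of_nonneg_left hθm hCθ0.le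
      _ = θ₁ := by rw [hCθ]; field_simp
  have hθI : θ' ∈ Set.Icc 0 θ₁ := ⟨hθ'0, hθ'1⟩
  have hnC'ϱ₁ : nC' ≤ ϱ₁ * E.N m := mul_le_mul_of_nonneg_right hlamϱ hNm.le
  have hnCn : nC' ≤ ϱ₁ * (E.N (m + 1) : ℕ) := hnC'ϱ₁.trans (mul_le_mul_of_nonneg_left hNmono hϱ₁.le)
  have hnCν : nC' ≤ ϱ₁ * (ν / K) ^ (4 / 3 : ℝ) * (E.N (m + 1) : ℕ) := by
    have hTok := N_le_rpow_mul_N_of_hKr hK hν hNm hN hKr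
    calc nC' ≤ ϱ₁ * E.N m := hnC'ϱ₁
      _ ≤ ϱ₁ * ((ν / K) ^ (4 / 3 : ℝ) * E.N (m + 1)) := mul_le_mul_of_nonneg_left hTok hϱ₁.le
      _ = ϱ₁ * (ν / K) ^ (4 / 3 : ℝ) * (E.N (m + 1) : ℕ) := by ring
  -- the graded products `θ·nC^l` only grow under the rescaling
  have hpow : ∀ {θ₀ ϱ₀ : ℝ}, 0 ≤ θ₀ → θ₀ ≤ CM → 0 ≤ ϱ₀ → ϱ₀ ≤ ϱs → ∀ l : ℕ, 1 ≤ l → l ≤ 6 →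
      θ₀ * E.strain m * (ϱ₀ * E.N m) ^ l ≤ θ' * nC' ^ l := by
    intro θ₀ ϱ₀ hθ₀ hθ₀C hϱ₀ hϱ₀s l _ hl6
    have h1 : θ₀ * E.strain m * (ϱ₀ * E.N m) ^ l ≤ CM * E.strain m * (ϱs * E.N m) ^ l :=
      mul_le_mul (mul_le_mul_of_nonneg_right hθ₀C hstrain0)
        (pow_le_pow_left₀ (mul_nonneg hϱ₀ hNm.le) (mul_le_mul_of_nonneg_right hϱ₀s hNm.le) l)
        (pow_nonneg (mul_nonneg hϱ₀ hNm.le) _) (mul_nonneg hCM0.le hstrain0)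
    have h2 := rescale_pow_le (mul_nonneg hCM0.le hstrain0) (mul_nonneg hϱs0.le hNm.le) hlam0 hlam1 l hl6
    refine h1.trans (h2.trans (le_of_eq ?_))
    rw [hθ'def, hnC'def, hCθ, hϱ']; ring
  have hmod' : IsFrameModulation θ' Tw nC'
      (fun τ y => frameG E m ((j : ℝ) * R + max 0 (min τ (E.a (m + 1) * (t - (j : ℝ) * R))) / E.a (m + 1)) ((j : ℝ) * R) y) := by
    refine isFrameModulation_rescale hmod ?_ ?_ hTw
    · exact mul_le_mul_of_nonneg_right ((le_max_left _ _).trans (le_div_self hCM0.le (pow_pos hlam0 6)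
        (pow_le_one₀ hlam0.le hlam1))) hstrain0
    · simpa only [pow_one] using hpow (hCα.le) (le_max_left _ _) hϱ.le (le_max_left _ _) 1 le_rfl (by norm_num)
  have hreg' : IsFrameRegular θ' Tw nC'
      (fun τ y => frameG E m ((j : ℝ) * R + max 0 (min τ (E.a (m + 1) * (t - (j : ℝ) * R))) / E.a (m + 1)) ((j : ℝ) * R) y)
      (fun τ y => frameJac E m ((j : ℝ) * R + max 0 (min τ (E.a (m + 1) * (t - (j : ℝ) * R))) / E.a (m + 1)) ((j : ℝ) * R) y) :=
    isFrameRegular_rescale hreg.1 fun l hl1 hl6 => hpow hCr.le (le_max_right _ _) hϱr.le (le_max_right _ _) l hl1 hl6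
  have hreg6' : IsFrameRegular6 θ' Tw nC'
      (fun τ y => frameG E m ((j : ℝ) * R + max 0 (min τ (E.a (m + 1) * (t - (j : ℝ) * R))) / E.a (m + 1)) ((j : ℝ) * R) y)
      (fun τ y => frameJac E m ((j : ℝ) * R + max 0 (min τ (E.a (m + 1) * (t - (j : ℝ) * R))) / E.a (m + 1)) ((j : ℝ) * R) y) :=
    isFrameRegular6_rescale hreg.2 fun l hl1 hl6 => hpow hCr.le (le_max_right _ _) hϱr.le (le_max_right _ _) l hl1 hl6
  -- the two distorted members and the readings (unpacked)
  obtain ⟨Ut, Tt, hUt, hTt, ι, ι', hconj, hlossF, hlossA⟩ :=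
    frameConjugacy_unpacked_of_modulation E hLP hLR hdes Φ m j S hj0 hjt htR' ht1 hν hUm1 hUm h𝔸1 hlo₁ h𝔸0 hlo₀
  rw [hgain] at hTt
  -- the (V)-family member `𝔸 = ν • S`
  have hodd : Torus.OddSmall (ν • S) (ν * β) := hSo.smul ν
  have hwin : ∃ lam ∈ Set.Icc (1:ℝ) Λ, Torus.NearIso (ν • S) (ν * (lo / lam)) (ν * (hi * lam)) := ⟨lam₁, hlam₁, hSn.smul hν.le⟩
  have hsm : (1 / ν) • (ν • S) = S := by rw [smul_smul, one_div_mul_cancel hν.ne', one_smul]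
  have hΦo : Torus.OddSmall (Φ ν ((1 / ν) • (ν • S))) β := by rw [hsm]; exact hΦSo
  have hΦw : ∃ lam ∈ Set.Icc (1:ℝ) Λ, Torus.NearIso (Φ ν ((1 / ν) • (ν • S))) (lo / lam) (hi * lam) := by rw [hsm]; exact ⟨lam', hlam', hΦSn⟩
  -- the clause at the rescaled frame data
  have key := hMod ν hνI (E.N (m + 1)) hKn (ν • S) hodd hwin hΦo hΦw θ' hθI nC' hnC'0 hnCn hnCν Tw hTw _ hmod' _ hreg' hreg6'
    Ut Tt hUt hTt Tw hTw le_rfl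
  -- the error functional and its envelope
  set ηbar : ℝ := Cm * (Cm * (ν ^ σ' + ((⌈K / ν⌉₊ : ℝ) / E.N (m + 1)) ^ σ' + (Cθ * E.θ (m + 1)) ^ σ' + (ϱ' * E.N m / E.N (m + 1)) ^ σ')
      + (min 1 ((M * W.period / ν) / Tw)) ^ σ') with hηbar_def
  have hηle : Cm * (Cm * (ν ^ σ' + ((⌈K / ν⌉₊ : ℝ) / (E.N (m + 1) : ℕ)) ^ σ' + θ' ^ σ' + (nC' / (E.N (m + 1) : ℕ)) ^ σ')
      + (min 1 ((M * W.period / ν) / Tw)) ^ σ') ≤ ηbar := by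
    rw [hηbar_def]
    exact eta_mono hCm hσ'0.le hθ'0 hθ'le (div_nonneg hnC'0 hN.le) (by rw [hnC'def, mul_div_assoc])
  have hWp : 0 < W.period := PermissibleCarrier.period_pos W
  have hT0 : 0 ≤ (min 1 ((M * W.period / ν) / Tw)) ^ σ' :=
    Real.rpow_nonneg (le_min zero_le_one (div_nonneg (div_nonneg (mul_nonneg hM.le hWp.le) hν.le) hTw.le)) σ'
  have hθpos : 0 ≤ E.θ (m + 1) := (E.θ_pos _).le
  have hρ0 : 0 ≤ (E.N m : ℝ) / E.N (m + 1) := by positivity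
  have hA0 : 0 ≤ ν ^ σ' := Real.rpow_nonneg hν.le σ'
  have hB0 : 0 ≤ ((⌈K / ν⌉₊ : ℝ) / E.N (m + 1)) ^ σ' := Real.rpow_nonneg (by positivity) σ'
  have h3 : 0 ≤ (Cθ * E.θ (m + 1)) ^ σ' := Real.rpow_nonneg (by positivity) σ'
  have h4 : 0 ≤ (ϱ' * E.N m / E.N (m + 1)) ^ σ' := Real.rpow_nonneg (by positivity) σ'
  have hηbar0 : 0 ≤ ηbar := by
    rw [hηbar_def]
    have : 0 ≤ Cm * (ν ^ σ' + ((⌈K / ν⌉₊ : ℝ) / E.N (m + 1)) ^ σ' + (Cθ * E.θ (m + 1)) ^ σ' + (ϱ' * E.N m / E.N (m + 1)) ^ σ') :=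
      mul_nonneg hCm (by linarith)
    exact mul_nonneg hCm (by linarith)
  -- steps (b)+(c): the Eulerian pair on the piece
  subst hs
  have hpiece := lossBound_of_frameKey hUm hUm1 ((j : ℝ) * E.refresh (m + 1)) t Tw hηbar0 hηle hconj hlossF hlossA key x y
  refine hpiece.trans ?_
  -- absorb `Cθ`, `ϱ'` into `Cm' = Cm·Lσ`
  have h1 : (Cθ * E.θ (m + 1)) ^ σ' ≤ Lσ * E.θ (m + 1) ^ σ' := by rw [hLσ]; exact mul_rpow_le_of_le hCθ0.le hCθL hθpos hσ'0
  have h2 : (ϱ' * E.N m / E.N (m + 1)) ^ σ' ≤ Lσ * ((E.N m : ℝ) / E.N (m + 1)) ^ σ' := by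
    rw [hLσ, mul_div_assoc]; exact mul_rpow_le_of_le hϱ'0.le hϱL hρ0 hσ'0
  have hθσ : 0 ≤ E.θ (m + 1) ^ σ' := Real.rpow_nonneg hθpos σ'
  have hρσ : 0 ≤ ((E.N m : ℝ) / E.N (m + 1)) ^ σ' := Real.rpow_nonneg hρ0 σ'
  have hsq0 : 0 ≤ Real.sqrt (lossFwd (Um ((j : ℝ) * E.refresh (m + 1)) t) x) * Real.sqrt (lossAdj (Um ((j : ℝ) * E.refresh (m + 1)) t) y) := by
    positivity
  have hinner : ν ^ σ' + ((⌈K / ν⌉₊ : ℝ) / E.N (m + 1)) ^ σ' + (Cθ * E.θ (m + 1)) ^ σ' + (ϱ' * E.N m / E.N (m + 1)) ^ σ'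
      ≤ Lσ * (ν ^ σ' + ((⌈K / ν⌉₊ : ℝ) / E.N (m + 1)) ^ σ' + E.θ (m + 1) ^ σ' + ((E.N m : ℝ) / E.N (m + 1)) ^ σ') := by
    have h3' : ν ^ σ' ≤ Lσ * ν ^ σ' := le_mul_of_one_le_left hA0 hLσ1
    have h4' : ((⌈K / ν⌉₊ : ℝ) / E.N (m + 1)) ^ σ' ≤ Lσ * ((⌈K / ν⌉₊ : ℝ) / E.N (m + 1)) ^ σ' := le_mul_of_one_le_left hB0 hLσ1
    have e : Lσ * (ν ^ σ' + ((⌈K / ν⌉₊ : ℝ) / E.N (m + 1)) ^ σ' + E.θ (m + 1) ^ σ' + ((E.N m : ℝ) / E.N (m + 1)) ^ σ')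
        = Lσ * ν ^ σ' + Lσ * ((⌈K / ν⌉₊ : ℝ) / E.N (m + 1)) ^ σ' + Lσ * E.θ (m + 1) ^ σ' + Lσ * ((E.N m : ℝ) / E.N (m + 1)) ^ σ' := by ring
    rw [e]
    exact add_le_add (add_le_add (add_le_add h3' h4') h1) h2
  have hCmL : 0 ≤ Cm * Lσ := mul_nonneg hCm (le_trans zero_le_one hLσ1)
  have hS0 : 0 ≤ ν ^ σ' + ((⌈K / ν⌉₊ : ℝ) / E.N (m + 1)) ^ σ' + E.θ (m + 1) ^ σ' + ((E.N m : ℝ) / E.N (m + 1)) ^ σ' := by linarith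
  calc ηbar * Real.sqrt (lossFwd (Um ((j : ℝ) * E.refresh (m + 1)) t) x) * Real.sqrt (lossAdj (Um ((j : ℝ) * E.refresh (m + 1)) t) y)
      = (Cm * (Cm * (ν ^ σ' + ((⌈K / ν⌉₊ : ℝ) / E.N (m + 1)) ^ σ' + (Cθ * E.θ (m + 1)) ^ σ' + (ϱ' * E.N m / E.N (m + 1)) ^ σ')
          + (min 1 ((M * W.period / ν) / Tw)) ^ σ'))
        * (Real.sqrt (lossFwd (Um ((j : ℝ) * E.refresh (m + 1)) t) x) * Real.sqrt (lossAdj (Um ((j : ℝ) * E.refresh (m + 1)) t) y)) := by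
        rw [hηbar_def]; ring
    _ ≤ (Cm * Lσ * (Cm * Lσ * (ν ^ σ' + ((⌈K / ν⌉₊ : ℝ) / E.N (m + 1)) ^ σ' + E.θ (m + 1) ^ σ' + ((E.N m : ℝ) / E.N (m + 1)) ^ σ')
          + (min 1 ((M * W.period / ν) / Tw)) ^ σ'))
        * (Real.sqrt (lossFwd (Um ((j : ℝ) * E.refresh (m + 1)) t) x) * Real.sqrt (lossAdj (Um ((j : ℝ) * E.refresh (m + 1)) t) y)) := by
        refine mul_le_mul_of_nonneg_right ?_ hsq0
        have hCmle : Cm ≤ Cm * Lσ := le_mul_of_one_le_right hCm hLσ1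
        have step1 : Cm * (ν ^ σ' + ((⌈K / ν⌉₊ : ℝ) / E.N (m + 1)) ^ σ' + (Cθ * E.θ (m + 1)) ^ σ' + (ϱ' * E.N m / E.N (m + 1)) ^ σ')
            ≤ Cm * Lσ * (ν ^ σ' + ((⌈K / ν⌉₊ : ℝ) / E.N (m + 1)) ^ σ' + E.θ (m + 1) ^ σ' + ((E.N m : ℝ) / E.N (m + 1)) ^ σ') := by
          have := mul_le_mul_of_nonneg_left hinner hCm
          linarith [this]
        have step2 : Cm * (Cm * (ν ^ σ' + ((⌈K / ν⌉₊ : ℝ) / E.N (m + 1)) ^ σ' + (Cθ * E.θ (m + 1)) ^ σ' + (ϱ' * E.N m / E.N (m + 1)) ^ σ')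
              + (min 1 ((M * W.period / ν) / Tw)) ^ σ')
            ≤ Cm * (Cm * Lσ * (ν ^ σ' + ((⌈K / ν⌉₊ : ℝ) / E.N (m + 1)) ^ σ' + E.θ (m + 1) ^ σ' + ((E.N m : ℝ) / E.N (m + 1)) ^ σ')
              + (min 1 ((M * W.period / ν) / Tw)) ^ σ') :=
          mul_le_mul_of_nonneg_left (by linarith [step1]) hCm
        refine step2.trans ?_
        have hin0 : 0 ≤ Cm * Lσ * (ν ^ σ' + ((⌈K / ν⌉₊ : ℝ) / E.N (m + 1)) ^ σ' + E.θ (m + 1) ^ σ' + ((E.N m : ℝ) / E.N (m + 1)) ^ σ')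
            + (min 1 ((M * W.period / ν) / Tw)) ^ σ' :=
          add_nonneg (mul_nonneg hCmL hS0) hT0
        exact mul_le_mul_of_nonneg_right hCmle hin0
    _ = (Cm * Lσ * (Cm * Lσ * (E.cellVisc (m + 1) ^ σ' + ((⌈K / E.cellVisc (m + 1)⌉₊ : ℝ) / E.N (m + 1)) ^ σ' + E.θ (m + 1) ^ σ'
            + ((E.N m : ℝ) / E.N (m + 1)) ^ σ')
          + (min 1 ((M * W.period / E.cellVisc (m + 1)) / (E.a (m + 1) * (t - (j : ℝ) * E.refresh (m + 1))))) ^ σ'))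
        * Real.sqrt (lossFwd (Um ((j : ℝ) * E.refresh (m + 1)) t) x) * Real.sqrt (lossAdj (Um ((j : ℝ) * E.refresh (m + 1)) t) y) := by
        rw [hνdef, hTwdef, hRdef]; ring

end Summit.AnomalousDissipation.AnomalousDissipation.Theorems.SolenoidalFractalHomogenisation.LagrangianStep.Z7Glue

end
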